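/-
Copyright: seat `ym-line-cbag-p2` (prover-ym-line-cbag-p2-g2-0), route `ColdBoxAllGroups`, crux `BulkAllGroups`
(stmt-QuantumFields-22255), line `dlr-chessboard-G` (skeleton `Cruxes/BulkAllGroups/Lines/birth.lean` v5).
-/
import Summits.QuantumFields.YangMills.Theorems.ColdBoxAllGroupsBulkAllGroupsRepresentationDatumGSteps

/-!
# Crux `BulkAllGroups` (stmt-QuantumFields-22255), stubs `stub_kernelCovExpansionG` / `stub_kernelMeanExpansionG`: the REPRESENTATION of
# the small-field conditioned DLR box kernel with an exterior datum as a bounded tilt of the conditioned `D`-colour Dirichlet Gaussian (T3),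
# every compact group presented in `U(N)`, exponential chart — part 2 (the theorem; Steps 1–3 in `…RepresentationDatumGSteps`)

`G`-generic port of `Theorems/WeakCouplingRatesColdBoxRepresentationDatum.lean` (the `SU(2)` trunk theorem T3 of the ϑ-datum pass of the proved
crux `BulkDominatesColdBoxW`: gnomonic chart, three colours), i.e. the ϑ-twin of the sibling crux's flat representation
`integral_cond_boxState_eq_integral_tilted_G` / `…_G'` (`Theorems/ColdBoxAllGroupsBoxFloorAllGroupsRepresentationG(Ball).lean`), in the datum
vocabulary of `Theorems/ColdBoxAllGroupsOneScaleDatumDefsG.lean` (`datVec`, `meanTE`, `chartCfgDE`, `cfgTDE`, `goodTDE`, `tiltWDE`; scale `√β`).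

**`integral_cond_boxKernelG_eq_integral_tilted_datum`** (`'` = density positive on the chart ball only).  Let `ρ : G →* U(N)` be faithful,
continuous and unitary, `β > 0`, `H ≥ 1`; let the exterior datum `W` have chart links `W e = ψ(ϑ_e)`, `ψ = expChart ρ`, `ϑ_e = datVec ϑ e`,
`‖ϑ_e‖ ≤ r` (`r ≥ 0`) for every `e` off the cold box `Λ = boxEdges 4 (2H+1)`; let `B = closedBall 0 m`, `m ≤ 1/4`, contain through `ψ` every
group element within the link window `‖ρ u − 1‖_F ≤ (12H²+2H+1)(√2·√(β^{2ε−1}) + 8r)` (`hball`); let the Haar measure in the chart have density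
`c·g` on `B` (`hdens`); and let the good events be charged.  Then for every measurable gauge-invariant `X ≥ 0`,
`∫ X d(γ_Λ(·|W)[|coldGoodSetG]) = ∫ X(cfgTDE ρ H β ϑ t) d(((gaussD H D)[|S]).tilted (𝟙_S·tiltWDE ρ H g β ϑ))(t)`,
`S = goodTDE ρ H β ε ϑ ∩ {t | ∀ e, ‖unscaleTE H D β (t + μ') e‖ ≤ m}` (`μ' = meanTE H D β ϑ` — the harmonic mean shift sits INSIDE `cfgTDE`;
the Gaussian reference stays the UNshifted `gaussD H D`).  All constants (`c^n`, `a`, `C`, `Z^D`) cancel (`integral_tilted_cond_eq_ratio`).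
No sorry; no new definition; standard axioms.  NOT a claim about the mass gap: rung-level support (R2xi-G `XiPow`, RECORD label); the
Yang–Mills mass gap is NOT proved by any of this.
-/

set_option autoImplicit false
set_option synthInstance.maxSize 4096

noncomputable section

open MeasureTheory ProbabilityTheory Finset Metric
open scoped ENNReal Matrix.Norms.Frobenius
open Literature.Probability.LatticeModels (Site glueWith glueWith_apply_mem glueWith_apply_not_mem measurable_glueWith)
open Literature.MathematicalPhysics.QuantumLattice
open Literature.MathematicalPhysics.QuantumFieldTheory
open Literature.MathematicalPhysics.QuantumFieldTheory.LatticeMaxwell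
open Literature.MathematicalPhysics.QuantumFieldTheory.AxialGauge
open Literature.MathematicalPhysics.QuantumFieldTheory.GaussianToolkit

namespace Summit.QuantumFields.YangMills.Theorems.ColdBoxAllGroups

open Summit.QuantumFields.YangMills.Theorems.WeakCouplingRates
open Summit.QuantumFields.YangMills.Theorems.FreeEnergyLogCoefficient

variable {H : ℕ}

section Box

variable {N : ℕ} {G : Type} [Group G] [TopologicalSpace G] [IsTopologicalGroup G] [CompactSpace G]
  [MeasurableSpace G] [BorelSpace G] [SecondCountableTopology G]
variable (ρ : G →* Matrix (Fin N) (Fin N) ℂ)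

/-! ## T3 — the representation with datum -/

/-- **T3 — THE REPRESENTATION WITH DATUM (every compact group presented in `U(N)`, density positive everywhere).**  See the module
docstring: for every measurable gauge-invariant `X ≥ 0`,
`∫ X d(γ_Λ(·|W)[|coldGoodSetG]) = ∫ X(cfgTDE ρ H β ϑ t) d(((gaussD H D)[|S]).tilted (𝟙_S·tiltWDE ρ H g β ϑ))(t)`,
`S = goodTDE ρ H β ε ϑ ∩ {t | ∀ e, ‖unscaleTE H D β (t + μ') e‖ ≤ m}`.  The flat theorem `integral_cond_boxState_eq_integral_tilted_G` is the case
`W ≡ 1`, `ϑ = 0`. -/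
theorem integral_cond_boxKernelG_eq_integral_tilted_datum (hρc : Continuous ρ) (hinj : Function.Injective ρ)
    (hρu : ∀ g, ρ g ∈ Matrix.unitaryGroup (Fin N) ℂ) {β ε r m : ℝ} (hβ : 0 < β) (hH : 1 ≤ H) (hr : 0 ≤ r) (hm : m ≤ 1 / 4)
    (hball : ∀ u : G, ‖ρ u - 1‖ ≤ (12 * (H : ℝ) ^ 2 + 2 * H + 1) * (Real.sqrt 2 * Real.sqrt (β ^ (2 * ε - 1)) + 8 * r) →
      u ∈ expChart ρ '' closedBall (0 : EuclideanSpace ℝ (Fin (dimE ρ))) m)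
    {W : LGConfig 4 G} {ϑ : Fin (dimE ρ) → (Literature.MathematicalPhysics.QuantumLattice.ZdEdge 4 → ℝ)}
    (hW : ∀ e, e ∉ boxEdges 4 (2 * H + 1) → W e = expChart ρ (datVec ϑ e))
    (hϑ : ∀ e, e ∉ boxEdges 4 (2 * H + 1) → ‖datVec ϑ e‖ ≤ r)
    {g : EuclideanSpace ℝ (Fin (dimE ρ)) → ℝ} (hgm : Measurable g) (hgpos : ∀ a, 0 < g a) {c : ℝ≥0∞} (hc0 : c ≠ 0) (hctop : c ≠ ∞)
    (hdens : (chartMeasureE ρ (1 / 4)).restrict (closedBall 0 m) =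
      (c • (volume : Measure (EuclideanSpace ℝ (Fin (dimE ρ)))).restrict (closedBall 0 m)).withDensity
        (fun a => ENNReal.ofReal (g a)))
    (hG0 : boxKernelG ρ β H W (coldGoodSetG ρ H β ε) ≠ 0)
    (hγ : gaussD H (dimE ρ) (goodTDE ρ H β ε ϑ ∩ {t | ∀ e, ‖unscaleTE H (dimE ρ) β (t + meanTE H (dimE ρ) β ϑ) e‖ ≤ m}) ≠ 0)
    {X : LGConfig 4 G → ℝ} (hXm : Measurable X) (hXinv : IsZdGaugeInvariant X) (hX0 : ∀ U, 0 ≤ X U) :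
    ∫ U, X U ∂((boxKernelG ρ β H W)[|coldGoodSetG ρ H β ε]) =
      ∫ t, X (cfgTDE ρ H β ϑ t) ∂(((gaussD H (dimE ρ))[|goodTDE ρ H β ε ϑ ∩
          {t | ∀ e, ‖unscaleTE H (dimE ρ) β (t + meanTE H (dimE ρ) β ϑ) e‖ ≤ m}]).tilted
        ((goodTDE ρ H β ε ϑ ∩ {t | ∀ e, ‖unscaleTE H (dimE ρ) β (t + meanTE H (dimE ρ) β ϑ) e‖ ≤ m}).indicator
          (tiltWDE ρ H g β ϑ))) := by
  have hSmeas : MeasurableSet (goodTDE ρ H β ε ϑ ∩ {t | ∀ e, ‖unscaleTE H (dimE ρ) β (t + meanTE H (dimE ρ) β ϑ) e‖ ≤ m}) :=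
    (measurableSet_goodTDE ρ hρc hinj β ε ϑ).inter (measurableSet_ball_unscaleTE_add (dimE ρ) β m _)
  haveI : IsProbabilityMeasure (gaussD H (dimE ρ)) := isProbabilityMeasure_gaussD H (dimE ρ)
  obtain ⟨a, ha0, hatop, ha⟩ := exists_lintegral_eq_mul_lintegral_unscaleTE_add (H := H) (dimE ρ) hβ
  obtain ⟨C, hC0, hCtop, hC⟩ := exists_boltzmann_mul_density_datum_eq (H := H) ρ g β ϑ
  have hC' : ∀ t : TSpaceD H (dimE ρ),
      ENNReal.ofReal (Real.exp (-β * wilsonBoundaryAction ρ (boxEdges 4 (2 * H + 1)) (cfgTDE ρ H β ϑ t))) *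
          ∏ e : ColdFreeIdx H, ENNReal.ofReal (g (unscaleTE H (dimE ρ) β (t + meanTE H (dimE ρ) β ϑ) e)) =
        C * (∏ i, gaussWeight (Qmat (fun e => e ∉ dirFreeEdges H) dirCorner (2 * H + 3)) (t i)) *
          ENNReal.ofReal (Real.exp (tiltWDE ρ H g β ϑ t)) := fun t => hC t (fun e => hgpos _)
  rw [integral_tilted_cond_eq_ratio (gaussD H (dimE ρ)) hSmeas hγ (measurable_tiltWDE ρ hρc hinj hgm β ϑ)
      (φ := fun t => X (cfgTDE ρ H β ϑ t)) (hXm.comp (measurable_cfgTDE ρ hρc hinj β ϑ)) (fun t => hX0 _),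
    integral_cond_boxKernelG_eq_ratio ρ hρc β ε H W hG0 hXm hXinv,
    freeIntegral_indicator_eq_lintegral_chart_datum_G ρ hρc hinj hρu hβ hH hr hm hball hW hϑ hgm hctop hdens hXm hX0,
    freeIntegral_indicator_eq_lintegral_chart_datum_G ρ hρc hinj hρu hβ hH hr hm hball hW hϑ hgm hctop hdens measurable_const
      (fun _ => zero_le_one),
    lintegral_chartD_eq_const_mul_lintegral_gaussD ρ hρc hinj ϑ hgm hXm hX0 (ha (meanTE H (dimE ρ) β ϑ)) hC',
    lintegral_chartD_eq_const_mul_lintegral_gaussD ρ hρc hinj ϑ hgm measurable_const (fun _ => zero_le_one)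
      (ha (meanTE H (dimE ρ) β ϑ)) hC']
  simp only [one_mul]
  obtain ⟨-, hZ0, hZtop⟩ := boxDirichlet_eq_withDensity H
  set K : ℝ := (c ^ Fintype.card (ColdFreeIdx H)).toReal * ((a * C).toReal *
      ((gaussZ (Qmat (fun e => e ∉ dirFreeEdges H) dirCorner (2 * H + 3))) ^ dimE ρ).toReal) with hK
  have hK0 : K ≠ 0 := by
    refine mul_ne_zero ?_ (mul_ne_zero (ENNReal.toReal_ne_zero.2 ⟨mul_ne_zero ha0 hC0, ENNReal.mul_ne_top hatop hCtop⟩) ?_)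
    · exact ENNReal.toReal_ne_zero.2 ⟨pow_ne_zero _ hc0, ENNReal.pow_ne_top hctop⟩
    · exact ENNReal.toReal_ne_zero.2 ⟨pow_ne_zero _ hZ0, ENNReal.pow_ne_top hZtop⟩
  have e1 : ∀ I : ℝ≥0∞, (c ^ Fintype.card (ColdFreeIdx H) *
      (a * C * gaussZ (Qmat (fun e => e ∉ dirFreeEdges H) dirCorner (2 * H + 3)) ^ dimE ρ * I)).toReal = K * I.toReal := by
    intro I; simp only [ENNReal.toReal_mul, hK]; ring
  rw [e1, e1, mul_div_mul_left _ _ hK0]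

omit [TopologicalSpace G] [IsTopologicalGroup G] [CompactSpace G] [MeasurableSpace G] [BorelSpace G] [SecondCountableTopology G] in
/-- On the window `S = goodTDE ∩ {∀ e, ‖a_e‖ ≤ m}`, the tilt with datum does not see the density off the ball. -/
theorem indicator_tiltWDE_ballClamp (g : EuclideanSpace ℝ (Fin (dimE ρ)) → ℝ) (β ε m : ℝ)
    (ϑ : Fin (dimE ρ) → (Literature.MathematicalPhysics.QuantumLattice.ZdEdge 4 → ℝ)) :
    (goodTDE ρ H β ε ϑ ∩ {t | ∀ e, ‖unscaleTE H (dimE ρ) β (t + meanTE H (dimE ρ) β ϑ) e‖ ≤ m}).indicator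
        (tiltWDE ρ H (fun a => if ‖a‖ ≤ m then g a else 1) β ϑ) =
      (goodTDE ρ H β ε ϑ ∩ {t | ∀ e, ‖unscaleTE H (dimE ρ) β (t + meanTE H (dimE ρ) β ϑ) e‖ ≤ m}).indicator (tiltWDE ρ H g β ϑ) := by
  funext t
  by_cases ht : t ∈ goodTDE ρ H β ε ϑ ∩ {t | ∀ e, ‖unscaleTE H (dimE ρ) β (t + meanTE H (dimE ρ) β ϑ) e‖ ≤ m}
  · rw [Set.indicator_of_mem ht, Set.indicator_of_mem ht, tiltWDE, tiltWDE]
    congr 1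
    exact Finset.sum_congr rfl fun e _ => by rw [if_pos (ht.2 e)]
  · rw [Set.indicator_of_notMem ht, Set.indicator_of_notMem ht]

/-- **T3' — THE REPRESENTATION WITH DATUM, density positive on the chart ball only** (the form consumed with the Helgason Jacobian `J` of
`…ChartDensityJ`, `hdens` verbatim from `exists_chartMeasureE_restrict_closedBall_eq_withDensity` with `c = ENNReal.ofReal cH`, `g = J`): as
`integral_cond_boxKernelG_eq_integral_tilted_datum`, with `hgpos : ∀ a, ‖a‖ ≤ m → 0 < g a` in place of global positivity. -/
theorem integral_cond_boxKernelG_eq_integral_tilted_datum' (hρc : Continuous ρ) (hinj : Function.Injective ρ)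
    (hρu : ∀ g, ρ g ∈ Matrix.unitaryGroup (Fin N) ℂ) {β ε r m : ℝ} (hβ : 0 < β) (hH : 1 ≤ H) (hr : 0 ≤ r) (hm : m ≤ 1 / 4)
    (hball : ∀ u : G, ‖ρ u - 1‖ ≤ (12 * (H : ℝ) ^ 2 + 2 * H + 1) * (Real.sqrt 2 * Real.sqrt (β ^ (2 * ε - 1)) + 8 * r) →
      u ∈ expChart ρ '' closedBall (0 : EuclideanSpace ℝ (Fin (dimE ρ))) m)
    {W : LGConfig 4 G} {ϑ : Fin (dimE ρ) → (Literature.MathematicalPhysics.QuantumLattice.ZdEdge 4 → ℝ)}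
    (hW : ∀ e, e ∉ boxEdges 4 (2 * H + 1) → W e = expChart ρ (datVec ϑ e))
    (hϑ : ∀ e, e ∉ boxEdges 4 (2 * H + 1) → ‖datVec ϑ e‖ ≤ r)
    {g : EuclideanSpace ℝ (Fin (dimE ρ)) → ℝ} (hgm : Measurable g) (hgpos : ∀ a, ‖a‖ ≤ m → 0 < g a) {c : ℝ≥0∞} (hc0 : c ≠ 0)
    (hctop : c ≠ ∞)
    (hdens : (chartMeasureE ρ (1 / 4)).restrict (closedBall 0 m) =
      (c • (volume : Measure (EuclideanSpace ℝ (Fin (dimE ρ)))).restrict (closedBall 0 m)).withDensity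
        (fun a => ENNReal.ofReal (g a)))
    (hG0 : boxKernelG ρ β H W (coldGoodSetG ρ H β ε) ≠ 0)
    (hγ : gaussD H (dimE ρ) (goodTDE ρ H β ε ϑ ∩ {t | ∀ e, ‖unscaleTE H (dimE ρ) β (t + meanTE H (dimE ρ) β ϑ) e‖ ≤ m}) ≠ 0)
    {X : LGConfig 4 G → ℝ} (hXm : Measurable X) (hXinv : IsZdGaugeInvariant X) (hX0 : ∀ U, 0 ≤ X U) :
    ∫ U, X U ∂((boxKernelG ρ β H W)[|coldGoodSetG ρ H β ε]) =
      ∫ t, X (cfgTDE ρ H β ϑ t) ∂(((gaussD H (dimE ρ))[|goodTDE ρ H β ε ϑ ∩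
          {t | ∀ e, ‖unscaleTE H (dimE ρ) β (t + meanTE H (dimE ρ) β ϑ) e‖ ≤ m}]).tilted
        ((goodTDE ρ H β ε ϑ ∩ {t | ∀ e, ‖unscaleTE H (dimE ρ) β (t + meanTE H (dimE ρ) β ϑ) e‖ ≤ m}).indicator
          (tiltWDE ρ H g β ϑ))) := by
  set g' : EuclideanSpace ℝ (Fin (dimE ρ)) → ℝ := fun a => if ‖a‖ ≤ m then g a else 1 with hg'
  have hg'm : Measurable g' := measurable_ballClamp hgm m
  have hg'pos : ∀ a, 0 < g' a := fun a => by
    by_cases ha : ‖a‖ ≤ m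
    · rw [hg']; dsimp only; rw [if_pos ha]; exact hgpos a ha
    · rw [hg']; dsimp only; rw [if_neg ha]; exact one_pos
  have hdens' : (chartMeasureE ρ (1 / 4)).restrict (closedBall 0 m) =
      (c • (volume : Measure (EuclideanSpace ℝ (Fin (dimE ρ)))).restrict (closedBall 0 m)).withDensity
        (fun a => ENNReal.ofReal (g' a)) := by
    rw [hdens]
    refine withDensity_congr_ae (Measure.ae_smul_measure ?_ c)
    filter_upwards [ae_restrict_mem (isClosed_closedBall.measurableSet :
      MeasurableSet (closedBall (0 : EuclideanSpace ℝ (Fin (dimE ρ))) m))] with a ha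
    rw [hg']; dsimp only; rw [if_pos (mem_closedBall_zero_iff.1 ha)]
  rw [← indicator_tiltWDE_ballClamp ρ g β ε m ϑ]
  exact integral_cond_boxKernelG_eq_integral_tilted_datum ρ hρc hinj hρu hβ hH hr hm hball hW hϑ hg'm hg'pos hc0 hctop hdens' hG0 hγ
    hXm hXinv hX0

end Box

end Summit.QuantumFields.YangMills.Theorems.ColdBoxAllGroups

end
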